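/-
Copyright (c) 2026. Released under Apache 2.0 license.
Literature formalization: Chen–Voutier, Theorem 5 (the irrationality measure for the roots of
`X⁴ - tX³ - 6X² + tX + 1`, `t ≥ 128`) and the resulting solution of the Thue equations.
-/
import Mathlib
import Literature.NumberTheory.DiophantineGeometry.SimplestQuarticThueRemainderBound
import Literature.NumberTheory.DiophantineGeometry.SimplestQuarticThueEndgame

/-!
# Chen–Voutier's Theorem 5 and the simplest quartic Thue equations for `t ≥ 128`

[cite: ChenVoutier1997, Theorem 5 and its proof, (3.14)–(3.15), and §3.2 (arXiv:1401.5450)]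

J. H. Chen and P. M. Voutier, *Complete solution of the Diophantine equation `X² + 1 = dY⁴` and a
related family of quartic Thue equations*, J. Number Theory **62** (1997), 71–99.

We assemble the hypergeometric method of §§2–3.1: with the Gaussian integers
`X_r + iY_r = (-i)^r u'^r p_r(w)` (`SimplestQuarticThueApproximants`), the bounds
`‖(-i)^r u'^r p_r(w)‖ ≤ (4√(t²+16))^r` and `‖w^{1/4} \overline{F_r} - F_r‖ ≤ (1/ε)(8/ε)^r`
(`SimplestQuarticThueRemainderBound`) and the relations
`β⁽⁰⁾ = i(w^{1/4}-1)/(w^{1/4}+1)`, `β⁽¹⁾ (w^{1/4} + i) = 1 + i w^{1/4}`, `β⁽¹⁾β⁽³⁾ = -1`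
(the vanishing `β^{(j)}(a(j)w^{1/4} - b(j)) - (c(j)w^{1/4} - d(j)) = 0` of §3.1 and (3.15)),
Lemma 8 (`ApproximationSequenceMeasure.one_div_lt_abs_sub_div_of_approx`) yields for `t ≥ 128`
and `j = 0, 1, 3` the measure
`|p - β^{(j)} q| > 1/(11.33 t · 0.4^κ |q|^κ)` for `|q| > 0.16 t`, with
`κ = log(4√(t²+16))/log(ε/8) < 3` (`measure_root_zero`, `measure_root_one`, `measure_root_three`,
`kappa'_lt_three`).  This is Theorem 5 for `j ≠ 2` except that the printed exponent
`κ = log(8ε)/log(ε/8)` (from Lemma 6) is replaced by the slightly larger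
`log(4√(t²+16))/log(ε/8) = log(8ε + 8/ε)/log(ε/8)`, still `< 3` for `t ≥ 128`, which is all that
§3.2 uses.  Feeding it into the endgame of §3.2 (`SimplestQuarticThueEndgame`) proves Theorem 3 for
`t ≥ 128` outright, so that `SimplestQuarticThueSolutions` follows from the case `1 ≤ t ≤ 127`
alone (`simplestQuarticThueSolutions_of_le_127`), which Chen–Voutier take from Lettl–Pethő
[LettlPetho1995].
-/

open Finset Complex GaussianInt
open scoped ComplexConjugate

namespace Literature.NumberTheory.DiophantineGeometry.SimplestQuarticThue

open Literature.NumberTheory.DiophantineApproximation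

/-! ### Elementary facts about `w^{1/4} = (ε+i)/ρ` and the roots -/

section omega

variable {ε ρ : ℝ}

/-- `(toComplex x).re = x.re` [folklore]. -/
theorem toComplex_re_eq (x : GaussianInt) : (toComplex x).re = x.re := by
  rw [toComplex_def₂]

/-- `(toComplex x).im = x.im` [folklore]. -/
theorem toComplex_im_eq (x : GaussianInt) : (toComplex x).im = x.im := by
  rw [toComplex_def₂]

/-- `toComplex x = x.re + x.im i` with real casts [folklore]. -/
theorem toComplex_eq_re_add_im (x : GaussianInt) :
    toComplex x = ((x.re : ℝ) : ℂ) + ((x.im : ℝ) : ℂ) * I := by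
  rw [toComplex_def]
  norm_cast

/-- `‖w^{1/4} + 1‖ ≥ 1` [cite: ChenVoutier1997, §3.1]. -/
theorem one_le_norm_omega_add_one (hε : 0 < ε) (hρ : 0 < ρ) (hρ2 : ρ ^ 2 = 1 + ε ^ 2) :
    1 ≤ ‖((ε : ℂ) + I) / ρ + 1‖ := by
  have hρ0 : (ρ : ℂ) ≠ 0 := by exact_mod_cast hρ.ne'
  have e : ((ε : ℂ) + I) / ρ + 1 = (((ε + ρ : ℝ) : ℂ) + I) / ρ := by
    push_cast
    field_simp
    ring
  rw [e, norm_div, Complex.norm_real, Real.norm_eq_abs, abs_of_pos hρ, le_div_iff₀ hρ, one_mul,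
    Complex.norm_def, normSq_apply]
  simp only [add_re, ofReal_re, I_re, add_zero, add_im, ofReal_im, I_im, zero_add, mul_one]
  calc ρ = Real.sqrt (ρ ^ 2) := (Real.sqrt_sq hρ.le).symm
    _ ≤ Real.sqrt ((ε + ρ) * (ε + ρ) + 1) := Real.sqrt_le_sqrt (by nlinarith)

/-- `w^{1/4} + 1 ≠ 0` [folklore]. -/
theorem omega_add_one_ne_zero (hε : 0 < ε) (hρ : 0 < ρ) (hρ2 : ρ ^ 2 = 1 + ε ^ 2) :
    ((ε : ℂ) + I) / ρ + 1 ≠ 0 := by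
  intro h0
  have := one_le_norm_omega_add_one hε hρ hρ2
  rw [h0, norm_zero] at this
  exact absurd this (by norm_num)

/-- The vanishing relation for `j = 0`: `β⁽⁰⁾ (w^{1/4} + 1) = i (w^{1/4} - 1)`, i.e.
`β⁽⁰⁾(a(0) w^{1/4} - b(0)) - (c(0)w^{1/4} - d(0)) = 0` with `a(0) = -5, b(0) = 5, c(0) = d(0) = -5i`
[cite: ChenVoutier1997, §3.1, "it is a routine matter to verify that, for `j = 0` and `1`, …"]. -/
theorem root_zero_mul_omega_add_one (hρ : 0 < ρ) (hρ2 : ρ ^ 2 = 1 + ε ^ 2) :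
    ((ε - ρ : ℝ) : ℂ) * (((ε : ℂ) + I) / ρ + 1) = I * (((ε : ℂ) + I) / ρ - 1) := by
  have hρ' : (ρ : ℂ) ^ 2 = 1 + (ε : ℂ) ^ 2 := by exact_mod_cast hρ2
  have hρ0 : (ρ : ℂ) ≠ 0 := by exact_mod_cast hρ.ne'
  have hII : I * I = -1 := I_mul_I
  push_cast
  field_simp
  linear_combination -hρ' - hII

/-- The vanishing relation for `j = 1`: `β⁽¹⁾ (w^{1/4} + i) = 1 + i w^{1/4}`, i.e.
`β⁽¹⁾(a(1) w^{1/4} - b(1)) - (c(1)w^{1/4} - d(1)) = 0` with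
`a(1) = 5i-5, b(1) = 5i+5, c(1) = -5-5i, d(1) = 5-5i` [cite: ChenVoutier1997, §3.1]. -/
theorem root_one_mul_omega_add_I (hε : 0 < ε) (hρ : 0 < ρ) (hρ2 : ρ ^ 2 = 1 + ε ^ 2) :
    (((ρ - 1) / ε : ℝ) : ℂ) * (((ε : ℂ) + I) / ρ + I) = 1 + I * (((ε : ℂ) + I) / ρ) := by
  have hρ' : (ρ : ℂ) ^ 2 = 1 + (ε : ℂ) ^ 2 := by exact_mod_cast hρ2
  have hρ0 : (ρ : ℂ) ≠ 0 := by exact_mod_cast hρ.ne'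
  have hε0 : (ε : ℂ) ≠ 0 := by exact_mod_cast hε.ne'
  have hII : I * I = -1 := I_mul_I
  push_cast
  field_simp
  linear_combination I * hρ' - (ε : ℂ) * hII

/-- `β⁽¹⁾ β⁽³⁾ = -1` [cite: ChenVoutier1997, §3.1, "`β⁽¹⁾β⁽³⁾ = -1`"]. -/
theorem root_one_mul_root_three (hε : 0 < ε) (hρ2 : ρ ^ 2 = 1 + ε ^ 2) :
    (ρ - 1) / ε * (-(ρ + 1) / ε) = -1 := by
  have hε0 : ε ≠ 0 := hε.ne'
  field_simp
  nlinarith [hρ2]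

/-- `0 < β⁽¹⁾ < 1` [cite: ChenVoutier1997, §3.2, `1 - 2/(t+1) < β⁽¹⁾ < 1 - 2/(t+2)`]. -/
theorem root_one_sq_le_one (hε : 0 < ε) (hρ : 0 < ρ) (hρ2 : ρ ^ 2 = 1 + ε ^ 2) :
    ((ρ - 1) / ε) ^ 2 ≤ 1 := by
  have h1 : 1 ≤ ρ := by nlinarith
  have h2 : ρ ≤ ε + 1 := by nlinarith
  rw [div_pow, div_le_one (by positivity)]
  nlinarith

/-- `|β⁽³⁾| ≤ 1.02` for `ε ≥ 64` [cite: ChenVoutier1997, §3.2, `-1-2/(t-1) < β⁽³⁾ < -1-2/t`]. -/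
theorem abs_root_three_le (hε : 64 < ε) (hρ : 0 < ρ) (hρ2 : ρ ^ 2 = 1 + ε ^ 2) :
    |(-(ρ + 1) / ε)| ≤ 102 / 100 := by
  have hε0 : 0 < ε := by linarith
  have hρε : ρ ≤ ε + 1 / 64 := by nlinarith
  rw [abs_div, abs_neg, abs_of_pos (by positivity), abs_of_pos hε0, div_le_iff₀ hε0]
  nlinarith

end omega

/-! ### From Lemma 8 to the measure: the common template -/

/-- **The template of the proof of Theorem 5** [cite: ChenVoutier1997, proof of Theorem 5]:
if `θ` has integer approximants `p_r, q_r` with `|q_r| ≤ √2 ‖F_r‖`,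
`|q_r θ - p_r| ≤ 1.02 ‖S_r‖`, `p_r q_{r+1} ≠ p_{r+1} q_r`, where `‖F_r‖ ≤ (4(4ε-t))^r` and
`‖S_r‖ ≤ (1/ε)(8/ε)^r`, then Lemma 8 with `k₀ = 1.415`, `Q = 4(4ε - t) = 4√(t²+16)`, `E = ε/8`,
`l₀ = 25/(8t)` (`2k₀Q < 11.33t`, `2El₀ < 0.4`, `1/(2l₀) = 0.16t`) gives
`|p - θq| > 1/(11.33t · 0.4^κ |q|^κ)` for `|q| > 0.16t`, `κ = log Q/log E`. -/
theorem measure_of_approximants {t : ℤ} {ε θ : ℝ} (ht : 128 ≤ t) (hε : 0 < ε)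
    (h : ε - ε⁻¹ = (t : ℝ) / 2) {F S : ℕ → ℂ} {p q : ℕ → ℤ}
    (hF : ∀ r, ‖F r‖ ≤ (4 * (4 * ε - t)) ^ r) (hS : ∀ r, ‖S r‖ ≤ 1 / ε * (8 / ε) ^ r)
    (hq : ∀ r, |(q r : ℝ)| ≤ Real.sqrt 2 * ‖F r‖)
    (happrox : ∀ r, |(q r : ℝ) * θ - p r| ≤ 102 / 100 * ‖S r‖)
    (hne : ∀ r, p r * q (r + 1) ≠ p (r + 1) * q r) (a b : ℤ) (hb : (4 / 25 : ℝ) * t < |(b : ℝ)|) :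
    1 / (1133 / 100 * t * (2 / 5 : ℝ) ^ (Real.log (4 * (4 * ε - t)) / Real.log (ε / 8)) *
        |(b : ℝ)| ^ (Real.log (4 * (4 * ε - t)) / Real.log (ε / 8))) < |(a : ℝ) - θ * b| := by
  have htR : (128 : ℝ) ≤ t := by exact_mod_cast ht
  have ht0 : (0 : ℝ) < t := by linarith
  obtain ⟨hε1, hε2⟩ := eps_bounds hε h ht0
  have hε64 : 64 < ε := by linarith
  have h2t : 2 / (t : ℝ) ≤ 1 / 64 := by
    rw [div_le_div_iff₀ ht0 (by norm_num)]; linarith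
  -- the constants of Lemma 8
  set k₀ : ℝ := 1415 / 1000 with hk₀
  set Q : ℝ := 4 * (4 * ε - t) with hQ
  set E : ℝ := ε / 8 with hE
  set l₀ : ℝ := 25 / (8 * t) with hl₀
  set κ : ℝ := Real.log Q / Real.log E with hκ
  have hQt : (t : ℝ) < 4 * ε - t := by linarith
  have hQ1 : 1 < Q := by rw [hQ]; linarith
  have hE1 : 1 < E := by rw [hE]; linarith
  have hl₀pos : 0 < l₀ := by positivity
  have hκ0 : 0 < κ := div_pos (Real.log_pos hQ1) (Real.log_pos hE1)
  -- `√2 < k₀`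
  have hsqrt2 : Real.sqrt 2 < k₀ := by
    rw [Real.sqrt_lt' (by norm_num)]; norm_num
  -- hypotheses of Lemma 8
  have hq' : ∀ r, |(q r : ℝ)| < k₀ * Q ^ r := by
    intro r
    have hQr : 0 < Q ^ r := by positivity
    calc |(q r : ℝ)| ≤ Real.sqrt 2 * ‖F r‖ := hq r
      _ ≤ Real.sqrt 2 * Q ^ r := mul_le_mul_of_nonneg_left (hF r) (Real.sqrt_nonneg _)
      _ < k₀ * Q ^ r := mul_lt_mul_of_pos_right hsqrt2 hQr
  have happrox' : ∀ r, |(q r : ℝ) * θ - p r| ≤ l₀ / E ^ r := by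
    intro r
    have h8 : (8 / ε) ^ r = 1 / E ^ r := by rw [hE, one_div, ← inv_pow, inv_div]
    have hcoef : 102 / 100 * (1 / ε) ≤ l₀ := by
      rw [hl₀, show (102 : ℝ) / 100 * (1 / ε) = 102 / (100 * ε) by field_simp,
        div_le_div_iff₀ (by positivity) (by positivity)]
      nlinarith
    calc |(q r : ℝ) * θ - p r| ≤ 102 / 100 * ‖S r‖ := happrox r
      _ ≤ 102 / 100 * (1 / ε * (8 / ε) ^ r) := mul_le_mul_of_nonneg_left (hS r) (by norm_num)
      _ = (102 / 100 * (1 / ε)) * (1 / E ^ r) := by rw [h8]; ring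
      _ ≤ l₀ * (1 / E ^ r) := mul_le_mul_of_nonneg_right hcoef (by positivity)
      _ = l₀ / E ^ r := by ring
  -- Lemma 8
  have hb' : 1 / (2 * l₀) ≤ |(b : ℝ)| := by
    have e : 1 / (2 * l₀) = 4 / 25 * t := by rw [hl₀]; field_simp; ring
    rw [e]; exact hb.le
  have hL := one_div_lt_abs_sub_div_of_approx (θ := θ) (by norm_num : (0 : ℝ) < k₀) hl₀pos hE1 hQ1
    hq' happrox' hne a b hb'
  -- from `|θ - a/b|` to `|a - θ b|`
  have hbpos : 0 < |(b : ℝ)| := lt_of_le_of_lt (by positivity) hb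
  have hb0 : (b : ℝ) ≠ 0 := abs_pos.mp hbpos
  have hab : |(a : ℝ) - θ * b| = |(b : ℝ)| * |θ - a / b| := by
    rw [← abs_mul, show (b : ℝ) * (θ - a / b) = -((a : ℝ) - θ * b) by field_simp; ring, abs_neg]
  rw [hab]
  rw [← hκ] at hL
  -- the constants: `2k₀Q(2El₀)^κ |b|^(κ+1) ≤ |b| · 11.33 t 0.4^κ |b|^κ`
  have hc1 : 2 * k₀ * Q ≤ 1133 / 100 * t := by
    rw [hk₀, hQ]; nlinarith
  have hc2 : 2 * E * l₀ ≤ 2 / 5 := by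
    rw [hE, hl₀, show 2 * (ε / 8) * (25 / (8 * t)) = 25 * ε / (32 * t) by ring,
      div_le_div_iff₀ (by positivity) (by norm_num)]
    nlinarith
  have hc2' : 0 ≤ 2 * E * l₀ := by positivity
  have hpow : (2 * E * l₀) ^ κ ≤ (2 / 5 : ℝ) ^ κ := Real.rpow_le_rpow hc2' hc2 hκ0.le
  have hbκ : 0 < |(b : ℝ)| ^ κ := Real.rpow_pos_of_pos hbpos κ
  have hEl : 0 < (2 * E * l₀) ^ κ := Real.rpow_pos_of_pos (by positivity) κ
  have h04 : 0 < (2 / 5 : ℝ) ^ κ := Real.rpow_pos_of_pos (by norm_num) κ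
  have hc : 2 * k₀ * Q * (2 * E * l₀) ^ κ ≤ 1133 / 100 * t * (2 / 5 : ℝ) ^ κ :=
    mul_le_mul hc1 hpow hEl.le (by positivity)
  have hrhs : |(b : ℝ)| * (1 / (2 * k₀ * Q * (2 * E * l₀) ^ κ * |(b : ℝ)| ^ (κ + 1))) =
      1 / (2 * k₀ * Q * (2 * E * l₀) ^ κ * |(b : ℝ)| ^ κ) := by
    rw [Real.rpow_add hbpos, Real.rpow_one]
    field_simp
  calc 1 / (1133 / 100 * t * (2 / 5 : ℝ) ^ κ * |(b : ℝ)| ^ κ)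
      ≤ 1 / (2 * k₀ * Q * (2 * E * l₀) ^ κ * |(b : ℝ)| ^ κ) :=
        one_div_le_one_div_of_le (by positivity) (mul_le_mul_of_nonneg_right hc hbκ.le)
    _ = |(b : ℝ)| * (1 / (2 * k₀ * Q * (2 * E * l₀) ^ κ * |(b : ℝ)| ^ (κ + 1))) := hrhs.symm
    _ < |(b : ℝ)| * |θ - a / b| := mul_lt_mul_of_pos_left hL hbpos

/-! ### The approximants: size, error, non-proportionality -/

section approximants

variable {t : ℤ} {ε ρ : ℝ}

/-- **Growth: `‖(-i)^r P_r‖ ≤ (4√(t²+16))^r = (4(4ε-t))^r`** (replacing (3.12) of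
[cite: ChenVoutier1997, §3.1]). -/
theorem norm_approximant_le (hε : 0 < ε) (h : ε - ε⁻¹ = (t : ℝ) / 2) (R : ℕ) :
    ‖toComplex ((⟨0, -1⟩ : GaussianInt) ^ R * ∑ s ∈ range (R + 1), (((2 * R - s).choose R *
        ((2 ^ s * ∏ i ∈ range s, (4 * (R - s + 1 + i) + 1)) / s.factorial) : ℕ) : GaussianInt) *
          (⟨-4, -t⟩ : GaussianInt) ^ (R - s))‖ ≤ (4 * (4 * ε - t)) ^ R := by
  rw [toComplex_approximantZi, norm_mul, norm_pow, norm_neg, norm_I, one_pow, one_mul]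
  have hP := norm_P_le (t : ℝ) R
  have hu := norm_u' hε h
  simp only [ofReal_intCast] at hP hu
  rw [hu] at hP
  have ht4 : 0 ≤ 4 * ε - t := by rw [← hu]; exact norm_nonneg _
  calc _ ≤ ((2 * R).choose R : ℝ) * (4 * ε - t) ^ R := hP
    _ ≤ 4 ^ R * (4 * ε - t) ^ R :=
        mul_le_mul_of_nonneg_right (centralBinom_le_four_pow_real R) (by positivity)
    _ = (4 * (4 * ε - t)) ^ R := by rw [mul_pow]

/-- The error term: `ω \overline{(-i)^r P_r} - (-i)^r P_r = (-i)^r (ω Q_r - P_r)` (any `ω`)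
[cite: ChenVoutier1997, §3.1, from `X_r^*(u',z') = ±\overline{X_r^*(z',u')}`]. -/
theorem approximant_error_eq (t : ℤ) (R : ℕ) (ω : ℂ) :
    ω * conj (toComplex ((⟨0, -1⟩ : GaussianInt) ^ R * ∑ s ∈ range (R + 1), (((2 * R - s).choose R *
        ((2 ^ s * ∏ i ∈ range s, (4 * (R - s + 1 + i) + 1)) / s.factorial) : ℕ) : GaussianInt) *
          (⟨-4, -t⟩ : GaussianInt) ^ (R - s))) - toComplex ((⟨0, -1⟩ : GaussianInt) ^ R * ∑ s ∈ range (R + 1), (((2 * R - s).choose R *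
        ((2 ^ s * ∏ i ∈ range s, (4 * (R - s + 1 + i) + 1)) / s.factorial) : ℕ) : GaussianInt) *
          (⟨-4, -t⟩ : GaussianInt) ^ (R - s)) =
      (-I) ^ R * (ω * (∑ ν ∈ range (R + 1), ((Ring.choose ((R : ℝ) - 1 / 4) ν *
        Ring.choose ((R : ℝ) + 1 / 4) (R - ν) : ℝ) : ℂ) * (4 - (t : ℂ) * I) ^ ν *
          (-4 - (t : ℂ) * I) ^ (R - ν)) - (∑ ν ∈ range (R + 1), ((Ring.choose ((R : ℝ) - 1 / 4) (R - ν) *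
        Ring.choose ((R : ℝ) + 1 / 4) ν : ℝ) : ℂ) * (4 - (t : ℂ) * I) ^ ν *
          (-4 - (t : ℂ) * I) ^ (R - ν))) := by
  rw [toComplex_approximantZi, map_mul, map_pow, map_neg, conj_I, neg_neg]
  have hc := homogQ_eq_conj (1 / 4) t R
  have hs : ((-1 : ℂ)) ^ R * (-1) ^ R = 1 := by rw [← mul_pow]; norm_num
  have hconj : conj (∑ ν ∈ range (R + 1), ((Ring.choose ((R : ℝ) - 1 / 4) (R - ν) *
        Ring.choose ((R : ℝ) + 1 / 4) ν : ℝ) : ℂ) * (4 - (t : ℂ) * I) ^ ν *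
          (-4 - (t : ℂ) * I) ^ (R - ν)) = (-1) ^ R * (∑ ν ∈ range (R + 1), ((Ring.choose ((R : ℝ) - 1 / 4) ν *
        Ring.choose ((R : ℝ) + 1 / 4) (R - ν) : ℝ) : ℂ) * (4 - (t : ℂ) * I) ^ ν *
          (-4 - (t : ℂ) * I) ^ (R - ν)) := by
    rw [hc, ← mul_assoc, hs, one_mul]
  rw [hconj]
  have hIR : I ^ R * (-1) ^ R = (-I) ^ R := by rw [← mul_pow]; ring_nf
  linear_combination (ω * (∑ ν ∈ range (R + 1), ((Ring.choose ((R : ℝ) - 1 / 4) ν *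
        Ring.choose ((R : ℝ) + 1 / 4) (R - ν) : ℝ) : ℂ) * (4 - (t : ℂ) * I) ^ ν *
          (-4 - (t : ℂ) * I) ^ (R - ν))) * hIR

/-- **Error: `‖w^{1/4} \overline{F_r} - F_r‖ ≤ (1/ε)(8/ε)^r`** for `F_r = (-i)^r P_r`
(cf. (3.13) of [cite: ChenVoutier1997, §3.1]). -/
theorem norm_approximant_error_le (hε : 0 < ε) (h : ε - ε⁻¹ = (t : ℝ) / 2) (hρ : 0 < ρ)
    (hρ2 : ρ ^ 2 = 1 + ε ^ 2) (R : ℕ) :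
    ‖((ε : ℂ) + I) / ρ * conj (toComplex ((⟨0, -1⟩ : GaussianInt) ^ R * ∑ s ∈ range (R + 1), (((2 * R - s).choose R *
        ((2 ^ s * ∏ i ∈ range s, (4 * (R - s + 1 + i) + 1)) / s.factorial) : ℕ) : GaussianInt) *
          (⟨-4, -t⟩ : GaussianInt) ^ (R - s))) - toComplex ((⟨0, -1⟩ : GaussianInt) ^ R * ∑ s ∈ range (R + 1), (((2 * R - s).choose R *
        ((2 ^ s * ∏ i ∈ range s, (4 * (R - s + 1 + i) + 1)) / s.factorial) : ℕ) : GaussianInt) *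
          (⟨-4, -t⟩ : GaussianInt) ^ (R - s))‖ ≤
      1 / ε * (8 / ε) ^ R := by
  rw [approximant_error_eq, norm_mul, norm_pow, norm_neg, norm_I, one_pow, one_mul]
  have hb := norm_omega_mul_Q_sub_P_le hε h hρ hρ2 R
  simp only [ofReal_intCast] at hb
  exact hb

/-- `|X + Y| ≤ √2 ‖X + iY‖` and `|X - Y| ≤ √2 ‖X + iY‖` [folklore]. -/
theorem abs_re_add_im_le (z : ℂ) : |z.re + z.im| ≤ Real.sqrt 2 * ‖z‖ ∧
    |z.re - z.im| ≤ Real.sqrt 2 * ‖z‖ := by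
  have hn : ‖z‖ ^ 2 = z.re ^ 2 + z.im ^ 2 := by rw [Complex.sq_norm, normSq_apply]; ring
  have h2 : Real.sqrt 2 * ‖z‖ = Real.sqrt (2 * ‖z‖ ^ 2) := by
    rw [Real.sqrt_mul (by norm_num), Real.sqrt_sq (norm_nonneg _)]
  constructor
  · rw [h2, ← Real.sqrt_sq_eq_abs]
    exact Real.sqrt_le_sqrt (by nlinarith [sq_nonneg (z.re - z.im)])
  · rw [h2, ← Real.sqrt_sq_eq_abs]
    exact Real.sqrt_le_sqrt (by nlinarith [sq_nonneg (z.re + z.im)])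

/-- `|X| ≤ √2 ‖X + iY‖` [folklore]. -/
theorem abs_re_le_sqrt_two_mul_norm (z : ℂ) : |z.re| ≤ Real.sqrt 2 * ‖z‖ := by
  have h1 : (1 : ℝ) ≤ Real.sqrt 2 := by
    rw [show (1 : ℝ) = Real.sqrt 1 from Real.sqrt_one.symm]
    exact Real.sqrt_le_sqrt (by norm_num)
  calc |z.re| ≤ ‖z‖ := abs_re_le_norm z
    _ = 1 * ‖z‖ := (one_mul _).symm
    _ ≤ Real.sqrt 2 * ‖z‖ := mul_le_mul_of_nonneg_right h1 (norm_nonneg _)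

end approximants

/-! ### The approximation errors for `β⁽⁰⁾` and `β⁽¹⁾` -/

section errors

variable {ε ρ : ℝ}

/-- **`j = 0`: `|X β⁽⁰⁾ + Y| ≤ ‖w^{1/4} \overline{F} - F‖`** for any Gaussian integer `F = X + iY`
(from `β⁽⁰⁾(w^{1/4}+1) = i(w^{1/4}-1)` and `|w^{1/4} + 1| ≥ 1`)
[cite: ChenVoutier1997, §3.1, (3.4): `Q_r β - P_r = S_r`]. -/
theorem root_zero_error_le (hε : 0 < ε) (hρ : 0 < ρ) (hρ2 : ρ ^ 2 = 1 + ε ^ 2) (z : GaussianInt) :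
    |((z.re : ℝ)) * (ε - ρ) - -((z.im : ℝ))| ≤
      ‖((ε : ℂ) + I) / ρ * conj (toComplex z) - toComplex z‖ := by
  set ω : ℂ := ((ε : ℂ) + I) / ρ with hω
  have hF := toComplex_eq_re_add_im z
  set X : ℝ := (z.re : ℝ) with hX
  set Y : ℝ := (z.im : ℝ) with hY
  have hconjF : conj (toComplex z) = (X : ℂ) - (Y : ℂ) * I := by
    rw [hF, map_add, map_mul, conj_ofReal, conj_ofReal, conj_I]; ring
  have hkey : (((X * (ε - ρ) + Y : ℝ)) : ℂ) * (ω + 1) = I * (ω * conj (toComplex z) - toComplex z) := by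
    have hr := root_zero_mul_omega_add_one hρ hρ2 (ε := ε)
    rw [← hω] at hr
    have hII : I * I = -1 := I_mul_I
    rw [hconjF, hF]
    push_cast at hr ⊢
    linear_combination (X : ℂ) * hr + (Y : ℂ) * (ω + 1) * hII
  have hnorm : |X * (ε - ρ) + Y| * ‖ω + 1‖ = ‖ω * conj (toComplex z) - toComplex z‖ := by
    rw [← Real.norm_eq_abs, ← Complex.norm_real, ← norm_mul, hkey, norm_mul, norm_I, one_mul]
  have h1 := one_le_norm_omega_add_one hε hρ hρ2
  rw [show X * (ε - ρ) - -Y = X * (ε - ρ) + Y by ring]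
  nlinarith [abs_nonneg (X * (ε - ρ) + Y), norm_nonneg (ω * conj (toComplex z) - toComplex z)]

/-- **`j = 1`: `|(X+Y) β⁽¹⁾ - (X-Y)| ≤ ‖w^{1/4} \overline{F} - F‖`** for any Gaussian integer
`F = X + iY` (from `β⁽¹⁾(w^{1/4}+i) = 1 + i w^{1/4}`, `|1+i| = √2`, `|w^{1/4}| = 1`,
`|iβ⁽¹⁾ - 1| ≤ √2`) [cite: ChenVoutier1997, §3.1, (3.4)]. -/
theorem root_one_error_le (hε : 0 < ε) (hρ : 0 < ρ) (hρ2 : ρ ^ 2 = 1 + ε ^ 2) (z : GaussianInt) :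
    |(((z.re : ℝ)) + (z.im : ℝ)) * ((ρ - 1) / ε) - ((z.re : ℝ) - (z.im : ℝ))| ≤
      ‖((ε : ℂ) + I) / ρ * conj (toComplex z) - toComplex z‖ := by
  set ω : ℂ := ((ε : ℂ) + I) / ρ with hω
  set θ : ℝ := (ρ - 1) / ε with hθ
  have hF := toComplex_eq_re_add_im z
  set X : ℝ := (z.re : ℝ) with hX
  set Y : ℝ := (z.im : ℝ) with hY
  have hconjF : conj (toComplex z) = (X : ℂ) - (Y : ℂ) * I := by
    rw [hF, map_add, map_mul, conj_ofReal, conj_ofReal, conj_I]; ring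
  have hkey : (1 + I) * ω * ((((X + Y) * θ - (X - Y) : ℝ)) : ℂ) =
      (I * θ - 1) * (ω * conj (toComplex z) - toComplex z) := by
    have hr := root_one_mul_omega_add_I hε hρ hρ2
    rw [← hω, show ((((ρ - 1) / ε : ℝ)) : ℂ) = (θ : ℂ) by rw [hθ]] at hr
    have hII : I * I = -1 := I_mul_I
    rw [hconjF, hF]
    push_cast
    linear_combination ((X : ℂ) + (Y : ℂ) * I) * hr + ω * (Y : ℂ) * ((θ : ℂ) + 1) * hII
  have hn1 : ‖(1 : ℂ) + I‖ = Real.sqrt 2 := by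
    rw [Complex.norm_def, normSq_apply]; norm_num
  have hnω : ‖ω‖ = 1 := by
    rw [hω, norm_div, Complex.norm_real, Real.norm_eq_abs, abs_of_pos hρ, div_eq_one_iff_eq hρ.ne',
      Complex.norm_def, normSq_apply]
    simp only [add_re, ofReal_re, I_re, add_zero, add_im, ofReal_im, I_im, zero_add, mul_one]
    rw [show ε * ε + 1 = ρ ^ 2 by rw [hρ2]; ring, Real.sqrt_sq hρ.le]
  have hnθ : ‖I * θ - 1‖ ≤ Real.sqrt 2 := by
    rw [Complex.norm_def, normSq_apply]
    simp only [sub_re, mul_re, I_re, ofReal_re, zero_mul, I_im, ofReal_im, mul_zero, sub_zero,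
      one_re, zero_sub, sub_im, mul_im, one_mul, zero_add, one_im]
    refine Real.sqrt_le_sqrt ?_
    nlinarith [root_one_sq_le_one hε hρ hρ2]
  have hnorm : Real.sqrt 2 * |(X + Y) * θ - (X - Y)| ≤
      Real.sqrt 2 * ‖ω * conj (toComplex z) - toComplex z‖ := by
    have := congrArg (fun z : ℂ => ‖z‖) hkey
    simp only [norm_mul, hn1, hnω, mul_one, Complex.norm_real, Real.norm_eq_abs] at this
    rw [this]
    exact mul_le_mul_of_nonneg_right hnθ (norm_nonneg _)
  exact le_of_mul_le_mul_left hnorm (by positivity)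

end errors

/-! ### Theorem 5 for `j = 0, 1, 3` -/

section measure

variable {t : ℤ} {ε ρ : ℝ}

/-- **Theorem 5, `j = 0`** [cite: ChenVoutier1997, Theorem 5]: for `t ≥ 128` and `|q| > 0.16t`,
`|p - β⁽⁰⁾ q| > 1/(11.33 t · 0.4^κ |q|^κ)` (with `κ = log(4√(t²+16))/log(ε/8)`); the approximants
are `q_r = X_r`, `p_r = -Y_r` where `X_r + iY_r = (-i)^r P_r`. -/
theorem measure_root_zero (ht : 128 ≤ t) (hε : 0 < ε) (h : ε - ε⁻¹ = (t : ℝ) / 2) (hρ : 0 < ρ)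
    (hρ2 : ρ ^ 2 = 1 + ε ^ 2) (a b : ℤ) (hb : (4 / 25 : ℝ) * t < |(b : ℝ)|) :
    1 / (1133 / 100 * t * (2 / 5 : ℝ) ^ (Real.log (4 * (4 * ε - t)) / Real.log (ε / 8)) *
        |(b : ℝ)| ^ (Real.log (4 * (4 * ε - t)) / Real.log (ε / 8))) <
      |(a : ℝ) - (ε - ρ) * b| := by
  refine measure_of_approximants ht hε h
    (F := fun R => toComplex ((⟨0, -1⟩ : GaussianInt) ^ R * ∑ s ∈ range (R + 1), (((2 * R - s).choose R *
        ((2 ^ s * ∏ i ∈ range s, (4 * (R - s + 1 + i) + 1)) / s.factorial) : ℕ) : GaussianInt) *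
          (⟨-4, -t⟩ : GaussianInt) ^ (R - s)))
    (S := fun R => ((ε : ℂ) + I) / ρ * conj (toComplex ((⟨0, -1⟩ : GaussianInt) ^ R * ∑ s ∈ range (R + 1), (((2 * R - s).choose R *
        ((2 ^ s * ∏ i ∈ range s, (4 * (R - s + 1 + i) + 1)) / s.factorial) : ℕ) : GaussianInt) *
          (⟨-4, -t⟩ : GaussianInt) ^ (R - s))) - toComplex ((⟨0, -1⟩ : GaussianInt) ^ R * ∑ s ∈ range (R + 1), (((2 * R - s).choose R *
        ((2 ^ s * ∏ i ∈ range s, (4 * (R - s + 1 + i) + 1)) / s.factorial) : ℕ) : GaussianInt) *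
          (⟨-4, -t⟩ : GaussianInt) ^ (R - s)))
    (p := fun R => -(((⟨0, -1⟩ : GaussianInt) ^ R * ∑ s ∈ range (R + 1), (((2 * R - s).choose R *
        ((2 ^ s * ∏ i ∈ range s, (4 * (R - s + 1 + i) + 1)) / s.factorial) : ℕ) : GaussianInt) *
          (⟨-4, -t⟩ : GaussianInt) ^ (R - s))).im) (q := fun R => (((⟨0, -1⟩ : GaussianInt) ^ R * ∑ s ∈ range (R + 1), (((2 * R - s).choose R *
        ((2 ^ s * ∏ i ∈ range s, (4 * (R - s + 1 + i) + 1)) / s.factorial) : ℕ) : GaussianInt) *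
          (⟨-4, -t⟩ : GaussianInt) ^ (R - s))).re)
    (norm_approximant_le hε h) (norm_approximant_error_le hε h hρ hρ2) (fun R => ?_) (fun R => ?_)
    (fun R => ?_) a b hb
  · -- `|q_r| ≤ √2 ‖F_r‖`
    rw [← toComplex_re_eq]
    exact abs_re_le_sqrt_two_mul_norm _
  · -- `|q_r β⁽⁰⁾ - p_r| ≤ 1.02 ‖S_r‖`
    have hS := root_zero_error_le hε hρ hρ2 ((⟨0, -1⟩ : GaussianInt) ^ R * ∑ s ∈ range (R + 1), (((2 * R - s).choose R *
        ((2 ^ s * ∏ i ∈ range s, (4 * (R - s + 1 + i) + 1)) / s.factorial) : ℕ) : GaussianInt) *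
          (⟨-4, -t⟩ : GaussianInt) ^ (R - s))
    simp only [Int.cast_neg]
    nlinarith [hS, norm_nonneg (((ε : ℂ) + I) / ρ * conj (toComplex ((⟨0, -1⟩ : GaussianInt) ^ R * ∑ s ∈ range (R + 1), (((2 * R - s).choose R *
        ((2 ^ s * ∏ i ∈ range s, (4 * (R - s + 1 + i) + 1)) / s.factorial) : ℕ) : GaussianInt) *
          (⟨-4, -t⟩ : GaussianInt) ^ (R - s))) - toComplex ((⟨0, -1⟩ : GaussianInt) ^ R * ∑ s ∈ range (R + 1), (((2 * R - s).choose R *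
        ((2 ^ s * ∏ i ∈ range s, (4 * (R - s + 1 + i) + 1)) / s.factorial) : ℕ) : GaussianInt) *
          (⟨-4, -t⟩ : GaussianInt) ^ (R - s)))]
  · -- non-proportionality
    intro hcontra
    apply re_mul_im_sub_ne_zero t R
    linear_combination hcontra

/-- **Theorem 5, `j = 1`** [cite: ChenVoutier1997, Theorem 5]: for `t ≥ 128` and `|q| > 0.16t`,
`|p - β⁽¹⁾ q| > 1/(11.33 t · 0.4^κ |q|^κ)`; the approximants are `q_r = X_r + Y_r`,
`p_r = X_r - Y_r`. -/
theorem measure_root_one (ht : 128 ≤ t) (hε : 0 < ε) (h : ε - ε⁻¹ = (t : ℝ) / 2) (hρ : 0 < ρ)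
    (hρ2 : ρ ^ 2 = 1 + ε ^ 2) (a b : ℤ) (hb : (4 / 25 : ℝ) * t < |(b : ℝ)|) :
    1 / (1133 / 100 * t * (2 / 5 : ℝ) ^ (Real.log (4 * (4 * ε - t)) / Real.log (ε / 8)) *
        |(b : ℝ)| ^ (Real.log (4 * (4 * ε - t)) / Real.log (ε / 8))) <
      |(a : ℝ) - (ρ - 1) / ε * b| := by
  refine measure_of_approximants ht hε h
    (F := fun R => toComplex ((⟨0, -1⟩ : GaussianInt) ^ R * ∑ s ∈ range (R + 1), (((2 * R - s).choose R *
        ((2 ^ s * ∏ i ∈ range s, (4 * (R - s + 1 + i) + 1)) / s.factorial) : ℕ) : GaussianInt) *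
          (⟨-4, -t⟩ : GaussianInt) ^ (R - s)))
    (S := fun R => ((ε : ℂ) + I) / ρ * conj (toComplex ((⟨0, -1⟩ : GaussianInt) ^ R * ∑ s ∈ range (R + 1), (((2 * R - s).choose R *
        ((2 ^ s * ∏ i ∈ range s, (4 * (R - s + 1 + i) + 1)) / s.factorial) : ℕ) : GaussianInt) *
          (⟨-4, -t⟩ : GaussianInt) ^ (R - s))) - toComplex ((⟨0, -1⟩ : GaussianInt) ^ R * ∑ s ∈ range (R + 1), (((2 * R - s).choose R *
        ((2 ^ s * ∏ i ∈ range s, (4 * (R - s + 1 + i) + 1)) / s.factorial) : ℕ) : GaussianInt) *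
          (⟨-4, -t⟩ : GaussianInt) ^ (R - s)))
    (p := fun R => (((⟨0, -1⟩ : GaussianInt) ^ R * ∑ s ∈ range (R + 1), (((2 * R - s).choose R *
        ((2 ^ s * ∏ i ∈ range s, (4 * (R - s + 1 + i) + 1)) / s.factorial) : ℕ) : GaussianInt) *
          (⟨-4, -t⟩ : GaussianInt) ^ (R - s))).re - (((⟨0, -1⟩ : GaussianInt) ^ R * ∑ s ∈ range (R + 1), (((2 * R - s).choose R *
        ((2 ^ s * ∏ i ∈ range s, (4 * (R - s + 1 + i) + 1)) / s.factorial) : ℕ) : GaussianInt) *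
          (⟨-4, -t⟩ : GaussianInt) ^ (R - s))).im)
    (q := fun R => (((⟨0, -1⟩ : GaussianInt) ^ R * ∑ s ∈ range (R + 1), (((2 * R - s).choose R *
        ((2 ^ s * ∏ i ∈ range s, (4 * (R - s + 1 + i) + 1)) / s.factorial) : ℕ) : GaussianInt) *
          (⟨-4, -t⟩ : GaussianInt) ^ (R - s))).re + (((⟨0, -1⟩ : GaussianInt) ^ R * ∑ s ∈ range (R + 1), (((2 * R - s).choose R *
        ((2 ^ s * ∏ i ∈ range s, (4 * (R - s + 1 + i) + 1)) / s.factorial) : ℕ) : GaussianInt) *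
          (⟨-4, -t⟩ : GaussianInt) ^ (R - s))).im)
    (norm_approximant_le hε h) (norm_approximant_error_le hε h hρ hρ2) (fun R => ?_) (fun R => ?_)
    (fun R => ?_) a b hb
  · push_cast
    rw [← toComplex_re_eq, ← toComplex_im_eq]
    exact (abs_re_add_im_le _).1
  · have hS := root_one_error_le hε hρ hρ2 ((⟨0, -1⟩ : GaussianInt) ^ R * ∑ s ∈ range (R + 1), (((2 * R - s).choose R *
        ((2 ^ s * ∏ i ∈ range s, (4 * (R - s + 1 + i) + 1)) / s.factorial) : ℕ) : GaussianInt) *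
          (⟨-4, -t⟩ : GaussianInt) ^ (R - s))
    simp only [Int.cast_add, Int.cast_sub]
    nlinarith [hS, norm_nonneg (((ε : ℂ) + I) / ρ * conj (toComplex ((⟨0, -1⟩ : GaussianInt) ^ R * ∑ s ∈ range (R + 1), (((2 * R - s).choose R *
        ((2 ^ s * ∏ i ∈ range s, (4 * (R - s + 1 + i) + 1)) / s.factorial) : ℕ) : GaussianInt) *
          (⟨-4, -t⟩ : GaussianInt) ^ (R - s))) - toComplex ((⟨0, -1⟩ : GaussianInt) ^ R * ∑ s ∈ range (R + 1), (((2 * R - s).choose R *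
        ((2 ^ s * ∏ i ∈ range s, (4 * (R - s + 1 + i) + 1)) / s.factorial) : ℕ) : GaussianInt) *
          (⟨-4, -t⟩ : GaussianInt) ^ (R - s)))]
  · intro hcontra
    apply re_mul_im_sub_ne_zero t R
    apply mul_left_cancel₀ (two_ne_zero : (2 : ℤ) ≠ 0)
    linear_combination hcontra

end measure

section measure3

variable {t : ℤ} {ε ρ : ℝ}

/-- **Theorem 5, `j = 3`** [cite: ChenVoutier1997, Theorem 5 and (3.15)]: for `t ≥ 128` and
`|q| > 0.16t`, `|p - β⁽³⁾ q| > 1/(11.33 t · 0.4^κ |q|^κ)`; by (3.15)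
(`-Q^{(1)} - β⁽³⁾P^{(1)} = β⁽³⁾ S^{(1)}`) the approximants are those of `j = 1` with the roles
of `p_r` and `q_r` switched: `q_r = X_r - Y_r`, `p_r = -(X_r + Y_r)`. -/
theorem measure_root_three (ht : 128 ≤ t) (hε : 0 < ε) (h : ε - ε⁻¹ = (t : ℝ) / 2) (hρ : 0 < ρ)
    (hρ2 : ρ ^ 2 = 1 + ε ^ 2) (a b : ℤ) (hb : (4 / 25 : ℝ) * t < |(b : ℝ)|) :
    1 / (1133 / 100 * t * (2 / 5 : ℝ) ^ (Real.log (4 * (4 * ε - t)) / Real.log (ε / 8)) *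
        |(b : ℝ)| ^ (Real.log (4 * (4 * ε - t)) / Real.log (ε / 8))) <
      |(a : ℝ) - -(ρ + 1) / ε * b| := by
  have hε64 : 64 < ε := eps_gt hε h (by exact_mod_cast ht)
  refine measure_of_approximants ht hε h
    (F := fun R => toComplex ((⟨0, -1⟩ : GaussianInt) ^ R * ∑ s ∈ range (R + 1), (((2 * R - s).choose R *
        ((2 ^ s * ∏ i ∈ range s, (4 * (R - s + 1 + i) + 1)) / s.factorial) : ℕ) : GaussianInt) *
          (⟨-4, -t⟩ : GaussianInt) ^ (R - s)))
    (S := fun R => ((ε : ℂ) + I) / ρ * conj (toComplex ((⟨0, -1⟩ : GaussianInt) ^ R * ∑ s ∈ range (R + 1), (((2 * R - s).choose R *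
        ((2 ^ s * ∏ i ∈ range s, (4 * (R - s + 1 + i) + 1)) / s.factorial) : ℕ) : GaussianInt) *
          (⟨-4, -t⟩ : GaussianInt) ^ (R - s))) - toComplex ((⟨0, -1⟩ : GaussianInt) ^ R * ∑ s ∈ range (R + 1), (((2 * R - s).choose R *
        ((2 ^ s * ∏ i ∈ range s, (4 * (R - s + 1 + i) + 1)) / s.factorial) : ℕ) : GaussianInt) *
          (⟨-4, -t⟩ : GaussianInt) ^ (R - s)))
    (p := fun R => -((((⟨0, -1⟩ : GaussianInt) ^ R * ∑ s ∈ range (R + 1), (((2 * R - s).choose R *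
        ((2 ^ s * ∏ i ∈ range s, (4 * (R - s + 1 + i) + 1)) / s.factorial) : ℕ) : GaussianInt) *
          (⟨-4, -t⟩ : GaussianInt) ^ (R - s))).re + (((⟨0, -1⟩ : GaussianInt) ^ R * ∑ s ∈ range (R + 1), (((2 * R - s).choose R *
        ((2 ^ s * ∏ i ∈ range s, (4 * (R - s + 1 + i) + 1)) / s.factorial) : ℕ) : GaussianInt) *
          (⟨-4, -t⟩ : GaussianInt) ^ (R - s))).im))
    (q := fun R => (((⟨0, -1⟩ : GaussianInt) ^ R * ∑ s ∈ range (R + 1), (((2 * R - s).choose R *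
        ((2 ^ s * ∏ i ∈ range s, (4 * (R - s + 1 + i) + 1)) / s.factorial) : ℕ) : GaussianInt) *
          (⟨-4, -t⟩ : GaussianInt) ^ (R - s))).re - (((⟨0, -1⟩ : GaussianInt) ^ R * ∑ s ∈ range (R + 1), (((2 * R - s).choose R *
        ((2 ^ s * ∏ i ∈ range s, (4 * (R - s + 1 + i) + 1)) / s.factorial) : ℕ) : GaussianInt) *
          (⟨-4, -t⟩ : GaussianInt) ^ (R - s))).im)
    (norm_approximant_le hε h) (norm_approximant_error_le hε h hρ hρ2) (fun R => ?_) (fun R => ?_)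
    (fun R => ?_) a b hb
  · push_cast
    rw [← toComplex_re_eq, ← toComplex_im_eq]
    exact (abs_re_add_im_le _).2
  · have hS := root_one_error_le hε hρ hρ2 ((⟨0, -1⟩ : GaussianInt) ^ R * ∑ s ∈ range (R + 1), (((2 * R - s).choose R *
        ((2 ^ s * ∏ i ∈ range s, (4 * (R - s + 1 + i) + 1)) / s.factorial) : ℕ) : GaussianInt) *
          (⟨-4, -t⟩ : GaussianInt) ^ (R - s))
    have h3 := abs_root_three_le hε64 hρ hρ2
    have h13 := root_one_mul_root_three hε hρ2 (ρ := ρ)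
    set X : ℝ := (((((⟨0, -1⟩ : GaussianInt) ^ R * ∑ s ∈ range (R + 1), (((2 * R - s).choose R *
        ((2 ^ s * ∏ i ∈ range s, (4 * (R - s + 1 + i) + 1)) / s.factorial) : ℕ) : GaussianInt) *
          (⟨-4, -t⟩ : GaussianInt) ^ (R - s))).re : ℤ) : ℝ) with hX
    set Y : ℝ := (((((⟨0, -1⟩ : GaussianInt) ^ R * ∑ s ∈ range (R + 1), (((2 * R - s).choose R *
        ((2 ^ s * ∏ i ∈ range s, (4 * (R - s + 1 + i) + 1)) / s.factorial) : ℕ) : GaussianInt) *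
          (⟨-4, -t⟩ : GaussianInt) ^ (R - s))).im : ℤ) : ℝ) with hY
    simp only [Int.cast_add, Int.cast_sub, Int.cast_neg]
    have e : (X - Y) * (-(ρ + 1) / ε) - -(X + Y) =
        -(-(ρ + 1) / ε) * ((X + Y) * ((ρ - 1) / ε) - (X - Y)) := by
      linear_combination (X + Y) * h13
    rw [e, abs_mul, abs_neg]
    calc |(-(ρ + 1) / ε)| * |(X + Y) * ((ρ - 1) / ε) - (X - Y)|
        ≤ 102 / 100 * |(X + Y) * ((ρ - 1) / ε) - (X - Y)| :=
          mul_le_mul_of_nonneg_right h3 (abs_nonneg _)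
      _ ≤ _ := mul_le_mul_of_nonneg_left hS (by norm_num)
  · intro hcontra
    apply re_mul_im_sub_ne_zero t R
    apply mul_left_cancel₀ (two_ne_zero : (2 : ℤ) ≠ 0)
    linear_combination hcontra

end measure3

/-! ### The exponent `κ = log(4√(t²+16))/log(ε/8)` -/

section kappa

variable {t ε : ℝ}

/-- `0 < κ` [cite: ChenVoutier1997, Theorem 5]. -/
theorem kappa'_pos (hε : 0 < ε) (h : ε - ε⁻¹ = t / 2) (ht : 128 ≤ t) :
    0 < Real.log (4 * (4 * ε - t)) / Real.log (ε / 8) := by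
  obtain ⟨hε1, _⟩ := eps_bounds hε h (by linarith)
  refine div_pos (Real.log_pos ?_) (Real.log_pos ?_)
  · linarith
  · rw [lt_div_iff₀ (by norm_num)]; linarith

/-- **`κ < 3` for `t ≥ 128`**: `4√(t²+16) = 8ε + 8/ε < (ε/8)³` because `ε - 64 ≥ 1/ε`
[cite: ChenVoutier1997, §3.2, "since `κ < 3`" (there for `κ = log(8ε)/log(ε/8)`)]. -/
theorem kappa'_lt_three (hε : 0 < ε) (h : ε - ε⁻¹ = t / 2) (ht : 128 ≤ t) :
    Real.log (4 * (4 * ε - t)) / Real.log (ε / 8) < 3 := by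
  obtain ⟨hε1, _⟩ := eps_bounds hε h (by linarith)
  have hlogE : 0 < Real.log (ε / 8) := Real.log_pos (by rw [lt_div_iff₀ (by norm_num)]; linarith)
  rw [div_lt_iff₀ hlogE, show (3 : ℝ) * Real.log (ε / 8) = Real.log ((ε / 8) ^ 3) by
    rw [Real.log_pow]; norm_num]
  refine Real.log_lt_log (by linarith) ?_
  -- `4(4ε - t) = 8ε + 8ε⁻¹ < (ε/8)³`
  have hinv : 0 < ε⁻¹ := inv_pos.mpr hε
  have hδ : ε⁻¹ ≤ ε - 64 := by linarith
  have h1 : 1 ≤ ε * (ε - 64) := by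
    have := mul_le_mul_of_nonneg_left hδ hε.le
    rwa [mul_inv_cancel₀ hε.ne'] at this
  have h2 : 4097 ≤ ε ^ 2 := by nlinarith
  have h4 : 4 * (4 * ε - t) = 8 * ε + 8 * ε⁻¹ := by linarith
  rw [h4]
  have h5 : 8 * ε + 8 * ε⁻¹ = (8 * ε ^ 2 + 8) / ε := by field_simp
  rw [h5, div_lt_iff₀ hε]
  nlinarith [h2, sq_nonneg ε, pow_pos hε 3]

end kappa

/-! ### Theorem 3 for `t ≥ 128`, and the reduction of the fact to `t ≤ 127` -/

/-- **Theorem 5 packaged for the endgame**: the measure for `β⁽⁰⁾, β⁽¹⁾, β⁽³⁾` with a common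
exponent `κ ∈ (0,3)` [cite: ChenVoutier1997, Theorem 5]. -/
theorem measure_roots {t : ℤ} {ε ρ : ℝ} (ht : 128 ≤ t) (hε : 0 < ε) (h : ε - ε⁻¹ = (t : ℝ) / 2)
    (hρ : 0 < ρ) (hρ2 : ρ ^ 2 = 1 + ε ^ 2) :
    ∀ β ∈ ({ε - ρ, (ρ - 1) / ε, -(ρ + 1) / ε} : Set ℝ), ∀ p q : ℤ, (4 / 25 : ℝ) * t < |(q : ℝ)| →
      1 / (1133 / 100 * t * (2 / 5 : ℝ) ^ (Real.log (4 * (4 * ε - t)) / Real.log (ε / 8)) *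
        |(q : ℝ)| ^ (Real.log (4 * (4 * ε - t)) / Real.log (ε / 8))) < |(p : ℝ) - β * q| := by
  intro β hβ p q hq
  simp only [Set.mem_insert_iff, Set.mem_singleton_iff] at hβ
  rcases hβ with rfl | rfl | rfl
  · exact measure_root_zero ht hε h hρ hρ2 p q hq
  · exact measure_root_one ht hε h hρ hρ2 p q hq
  · exact measure_root_three ht hε h hρ hρ2 p q hq

/-- **Theorem 3 for `t ≥ 128` (large solutions)** [cite: ChenVoutier1997, Theorem 3 via Theorem 5
and §3.2]: for `t ≥ 128` the equation `P_t(x,y) = ±1` has no solution with `5|y| ≥ t`. -/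
theorem no_large_solution {t : ℤ} (ht : 128 ≤ t) {x y : ℤ} (hy : t ≤ 5 * |y|)
    (hP : simplestQuarticForm t x y = 1 ∨ simplestQuarticForm t x y = -1) : False := by
  obtain ⟨ε, hε, h⟩ := exists_eps (t : ℝ)
  obtain ⟨ρ, hρ, hρ2⟩ := exists_rho ε
  have hT : (128 : ℝ) ≤ (t : ℝ) := by exact_mod_cast ht
  exact no_large_solution_of_measure ht hε h hρ hρ2 (kappa'_pos hε h hT) (kappa'_lt_three hε h hT)
    (measure_roots ht hε h hρ hρ2) hy hP

/-- **`SimplestQuarticThueSolutions` from the case `1 ≤ t ≤ 127` alone.**  Chen–Voutier's proof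
[cite: ChenVoutier1997, Theorem 3, §§2–3] settles `t ≥ 128` (formalised in this tree); for
`1 ≤ t ≤ 127` they refer to Lettl–Pethő [LettlPetho1995] (linear forms in two logarithms), which
is the remaining hypothesis, in the form: every solution with `|x|, |y| ≥ 2` (and
`5|x|, 5|y| > t - 1` when `t ≥ 5`) has `t = 4` and `(x,y) ∈ {(-3,2),(-2,-3),(2,3),(3,-2)}`. -/
theorem simplestQuarticThueSolutions_of_le_127
    (H127 : ∀ t : ℤ, 1 ≤ t → t ≤ 127 → t ≠ 3 → ∀ x y : ℤ, 2 ≤ |x| → 2 ≤ |y| →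
      (5 ≤ t → t - 1 < 5 * |x| ∧ t - 1 < 5 * |y|) →
      (simplestQuarticForm t x y = 1 ∨ simplestQuarticForm t x y = -1) →
        t = 4 ∧ (x, y) ∈ ({(-3, 2), (-2, -3), (2, 3), (3, -2)} : Set (ℤ × ℤ))) :
    SimplestQuarticThueSolutions := by
  refine simplestQuarticThueSolutions_of_large fun t ht ht3 x y hx hy hlarge hP => ?_
  rcases le_or_gt t 127 with h127 | h128
  · exact H127 t ht h127 ht3 x y hx hy hlarge hP
  · exfalso
    have ht128 : 128 ≤ t := by omega
    refine no_large_solution ht128 (x := x) (y := y) ?_ hP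
    have := (hlarge (by omega)).2
    omega

end Literature.NumberTheory.DiophantineGeometry.SimplestQuarticThue
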